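import Literature.MathematicalPhysics.QuantumFieldTheory.Balaban1983to89.B9SectBStepUParHOfMembers

/-!
# `Balaban1983to89.B9SectBStepUParHExtraYPb` — T. Bałaban, *Propagators for lattice gauge theories in a background field*, Commun. Math. Phys. **99** (1985) 389–434
# [Balaban1985BackgroundPropagators], Thm 3.4 p. 400 ∕ Sect. B pp. 400–407 with (3.35) p. 396 and p. 404 («… follow directly from the assumptions (3.35)»):
# THE TWO-TRANSPORTER SECT.-B STEP AT THE RECORD's READING OF PRINT's CLASS (`𝔸 = M_N(ℂ)`, `P := extraYPb`, Hölder transporter `parSymY`) — the plaquette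
# displays `hreg335P ∕ hplaq` and the Hölder-transporter laws DISCHARGED (pub-ymgap N06 [B9]; CASCADE-K step K1, the (C) road, module F6)

statement-level skeleton of published theorems with citation tags; proofs where landed; nothing here is a claim about the Yang–Mills mass gap

THE PRINT.  Sect. B's step is stated on print's class (3.35)–(3.37); (3.35) at scale `j` includes the plaquette bound `|U(∂p) − 1| < α₀(Lʲη)²M²`-type control from
which the L² step's plaquette law follows (p. 404, after (3.69)).

WHY THIS FILE (pub-ymgap node N06 [B9]; CASCADE-K K1, the junction `B9SectBStepUParHOfMembers.sectBStepUPar_parSymYH_of_members`).  The step of record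
`B9SectBStepUGuardedR.sectBStepU_C37GY_unitary_extraYPb` discharges, at the record's reading of print's class `P := extraYPb` (`𝔸 = M_N(ℂ)`, `N ≥ 1`), the two plaquette
displays (`hreg335P := hreg335P_extraYPb`, `hplaq := plaqLawY_of_reg335PlaqY ∘ hreg335P_extraYPb`, constants `c335Plaq ℓ aInv`, `2·c335Plaq ℓ aInv`) and — at
`par := parSymY` — the transporter laws.  THIS FILE does the same for the two-transporter step with the AVERAGING transporter `parA` LEFT FREE:
★★★ `sectBStepUPar_parSymYH_extraYPb` — `SectBStepUPar (extraYPb …) f (d+1) c35 G b parA parSymY (GAY parA parBY (GpY parA)) parBY C37 C38 (CinvY … parA)` with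
`hparH ∕ hLip` (at `parSymY`), `hreg335P ∕ hplaq` (at `extraYPb`) DISCHARGED; DISPLAYED: the structural data, the five AVERAGING-transporter laws `hpar hunit hunitX hsym hunitA`
at `parA`, the coded-class dictionaries `hC37` (complex letters AT `parA`) ∕ `hC37G` ∕ `hvarB` (the class `C37` stays a parameter: the record's `C37GY` carries the complex
letters at `parSymY`, a knit class is node00-def-Y's choice), the Lemma-2.1 datum `(d261, h261)`, the record's Thm 3.2 `h32` and the coded-level Thm 3.3 `h33`.

HONEST SCOPE ∕ NOT CLAIMED.  One instantiation of a landed assembly with two landed discharges; nothing of [B9] asserted; every remaining display is a hypothesis;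
count-neutral; N06 NOT discharged; nothing continuum ∕ OS ∕ mass gap ∕ Clay.  NEW file; no `sorry`, no `axiom`, no `instance`, no `notation`; 0 `def`.  Cell `pub-ymgap`
(D-0062), seat `pub-ymgap-dag-n06-c` (gen 24), 2026-08-30; `--supports stmt-QuantumFields-27364`.  Net new unproved facts: 0.

RELATED IN THE TREE, NOT DUPLICATED (searched 2026-08-30: `rg 'sectBStepUPar_parSymYH_extraYPb' lean/Literature lean/Summits` — 0 hits):
`B9SectBStepUGuardedR` §4 (`sectBStepU_C37GY_unitary_extraYPb` — the diagonal instance `parA = parSymY`, `C37 := C37GY`), `B9SectBGReg335PlaqYOfClassPb` (`hreg335P_extraYPb`,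
`c335Plaq`, USED), `B9SectBL2GCrossY` (`plaqLawY_of_reg335PlaqY`, USED), `B9SectBStepUParHOfMembers` (USED).
-/

noncomputable section

namespace Literature.MathematicalPhysics.QuantumFieldTheory.Balaban1983to89.B9SectBStepUParHExtraYPb

open scoped Matrix.Norms.L2Operator
open Literature.MathematicalPhysics.QuantumFieldTheory.Balaban1983to89.B9SectBCodedClassR (RegExtraY bg9YC extraYPb)
open Literature.MathematicalPhysics.QuantumFieldTheory.Balaban1983to89.B9SectBStepUParHOfMembers (sectBStepUPar_parSymYH_of_members)
open B6Ineq2142KLevelV1 (β)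
open B6RandomWalk (Ineq261)
open B9Thm34Ext (toB6)
open B9PinMembersKLevelV1 (MemberY geo9Y bg9Y)
open B9Eq360DeltaPrimeAY (AfldY)
open B9SectBGpLettersY (GVal)
open B9SectBGpFrameCodedYR (codingYx)
open B9SectBGpFrameCodedY (CplxLettersY)
open B9SectBCodedCarrier (pullS)
open B9SectBCodedReadingsUR (KACU)
open B9SectBCodedReadingsUParH (KSCUPar SectBStepUPar Thm34UPar)
open B9SectBKerFrameCodedYR (CinvY)
open B9RWSumsReadsNbr (nbr)
open B9SectBGClassLettersY (Reg335PlaqY CplxLettersGY VarParBY)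
open B9SectBGFrameCodedYRG (gFrame₅CodedOn)
open B9Eq340HolderLipParBY (hparB_parBY)
open B9Eq340TaxiContourLocalityY (rLB)
open B9SectBGReg335PlaqYOfClassPb (c335Plaq c335Plaq_nonneg hreg335P_extraYPb)
open B9SectBL2GCrossY (plaqLawY_of_reg335PlaqY)
open Node00 (SiteY BlkY IBondY CfgY SiteParY GAY GpY XY deltaAY deltaPrimeAY parSymY parBY parSymY_mem kernelFamilyS kernelFamilyB)

variable {d ℓ : ℕ} {hd : 1 ≤ d + 1} {hL : Odd (ℓ + 1) ∧ 1 < ℓ + 1} {b₀ b₁ : ℝ} {Mstar : ℕ}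

variable {N : ℕ} {J : Type} (f : J → MemberY d ℓ hd hL b₀ b₁ Mstar) [∀ x : MemberY d ℓ hd hL b₀ b₁ Mstar, Fintype (geo9Y x).Site]
  [instDS : ∀ x : MemberY d ℓ hd hL b₀ b₁ Mstar, DecidableEq (geo9Y x).Site] [instNE : ∀ x : MemberY d ℓ hd hL b₀ b₁ Mstar, Nonempty (geo9Y x).Site]
  (c35 : ℝ) (G : Subgroup (Matrix (Fin N) (Fin N) ℂ)ˣ) {ι : Type} [Fintype ι] [DecidableEq ι] (b : Module.Basis ι ℝ (Matrix (Fin N) (Fin N) ℂ))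
  (ιB : ∀ j : J, BlkY (f j).toKIdx → IBondY (f j).toKIdx)
  (C37 C38 : ∀ j : J, ℝ → CfgY (Matrix (Fin N) (Fin N) ℂ) (f j).toKIdx → AfldY (Matrix (Fin N) (Fin N) ℂ) (f j).toKIdx → Prop)
  (parA : ∀ j : J, SiteParY (Matrix (Fin N) (Fin N) ℂ) (f j).toKIdx)

/-- ★★★ **THE TWO-TRANSPORTER SECT.-B STEP AT THE RECORD's READING OF PRINT's CLASS, HÖLDER TRANSPORTER `parSymY`, PLAQUETTE DISPLAYS DISCHARGED** (`𝔸 = M_N(ℂ)`,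
`N ≥ 1`, `P := extraYPb`): `B9SectBStepUParHOfMembers.sectBStepUPar_parSymYH_of_members` with `C₀ := c335Plaq ℓ aInv`, `hreg335P := hreg335P_extraYPb …` and
`cP := 2·c335Plaq ℓ aInv`, `hplaq := plaqLawY_of_reg335PlaqY ∘ hreg335P_extraYPb`.  DISPLAYED: `hι hG1 b M₂ hrepr hcR hcL`, `MInv aInv aW` (`hMInv haInv haW hMd hMr`), the
five AVERAGING-transporter laws AT `parA` (`hpar hunit hunitX hsym`, GUARDED `hunitA`), the class dictionaries `hC37` (complex letters at `parA`) ∕ `hC37G` ∕ `hvarB`, `hb₁`,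
`mN hnbr`, the Lemma-2.1 datum `(d261, h261)` at `C₀ := c335Plaq ℓ aInv`, the record's Thm 3.2 `h32`, the coded-level Thm 3.3 `h33`; `C37`, `C38` free.
[cite: Balaban1985BackgroundPropagators, Thm 3.4 p.400, Sect. B pp.400–407, (3.35) p.396, p.404 (after (3.69)), (3.21) p.394, (3.40) p.397; Balaban1984PropagatorsII, Lemma 2.1 p.234, (2.51) p.232] -/
theorem sectBStepUPar_parSymYH_extraYPb [Nonempty (Fin N)] [NormOneClass (Matrix (Fin N) (Fin N) ℂ)] [FiniteDimensional ℝ (Matrix (Fin N) (Fin N) ℂ)]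
    (hι : ∀ (j : J) (s : BlkY (f j).toKIdx), β (f j).toKIdx.hN (f j).toKIdx.D (f j).toKIdx.hk (ιB j s) = s)
    (hG1 : ∀ u : (Matrix (Fin N) (Fin N) ℂ)ˣ, u ∈ G → ‖(u : Matrix (Fin N) (Fin N) ℂ)‖ ≤ 1)
    (hpar : ∀ j (U : CfgY (Matrix (Fin N) (Fin N) ℂ) (f j).toKIdx), GVal G (f j).toKIdx U → ∀ z w, parA j U z w ∈ G)
    (hunit : ∀ j (U : CfgY (Matrix (Fin N) (Fin N) ℂ) (f j).toKIdx), GVal G (f j).toKIdx U → IsUnit (deltaPrimeAY (f j).toKIdx (parA j) U))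
    (M₂ : ℝ) (hM₂ : 0 ≤ M₂) (hrepr : ∀ (v : Matrix (Fin N) (Fin N) ℂ) (j : ι), |b.repr v j| ≤ M₂ * ‖v‖) (hcR : 0 < M₂ * ∑ j, ‖b j‖)
    (hcL : 0 < Real.sqrt (Fintype.card ι) * M₂ * ∑ j, ‖b j‖)
    (Cq : ℝ) (hCq : 0 ≤ Cq)
    (hC37 : ∀ j β' U a, C37 j β' U a → GVal G (f j).toKIdx U ∧ CplxLettersY G (f j) (parA j) (ιB j) Cq β' U a)
    (MInv aInv aW : ℝ) (hMInv : 0 < MInv) (haInv : 0 < aInv) (haW : 0 < aW)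
    (hunitX : ∀ j (U : CfgY (Matrix (Fin N) (Fin N) ℂ) (f j).toKIdx), GVal G (f j).toKIdx U → IsUnit (XY (f j).toKIdx (parA j) (GpY (f j).toKIdx (parA j)) U))
    (hsym : ∀ j (U : CfgY (Matrix (Fin N) (Fin N) ℂ) (f j).toKIdx) (z w : SiteY (f j).toKIdx), parA j U z w = (parA j U w z)⁻¹)
    (hunitA : ∀ j (α₀ : ℝ) (U : CfgY (Matrix (Fin N) (Fin N) ℂ) (f j).toKIdx), MInv ≤ (geo9Y (f j)).M → 0 < α₀ → (geo9Y (f j)).M * α₀ ≤ aInv →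
      (bg9YC (Matrix (Fin N) (Fin N) ℂ) G (extraYPb (Matrix (Fin N) (Fin N) ℂ) G) (f j)).Reg335 c35 α₀ U →
      IsUnit (deltaAY (f j).toKIdx (parA j) (parBY (f j).toKIdx) (GpY (f j).toKIdx (parA j)) U)) (hb₁ : 0 ≤ b₁)
    (hC37G : ∀ j β' U a, C37 j β' U a → CplxLettersGY G (f j) (ιB j) β' U a)
    (cVar : ℝ) (hcVar : 0 ≤ cVar) (hvarB : ∀ j β' U a, C37 j β' U a → VarParBY (f j).toKIdx (parBY (f j).toKIdx) cVar β' U a)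
    (hMd : 2 * ((d : ℝ) + 1) < MInv) (mN : ℕ) (hnbr : ∀ (j : J) (y' : IBondY (f j).toKIdx), (nbr (geo9Y (f j)) (2 * ((d : ℝ) + 1)) y').card ≤ mN)
    (hMr : rLB d ℓ + 1 < MInv)
    (d261 : ℝ → ℕ)
    (h261 : ∀ (j : J) (δ α : ℝ), 0 < δ → δ ≤ 1 → 9 / 5000 ≤ α → α < 1 →
      (gFrame₅CodedOn (extraYPb (Matrix (Fin N) (Fin N) ℂ) G) f c35 G parA (fun j => parBY (f j).toKIdx) b ιB C37 C38 hι hG1 hpar hunit M₂ hM₂ hrepr hcR Cq hCq hC37 MInv aInv aW hMInv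
        haInv haW hunitX hsym hunitA (hparB_parBY f G) hb₁ (c335Plaq ℓ aInv) (c335Plaq_nonneg ℓ haInv.le) (hreg335P_extraYPb G f ιB hι hMd aInv c35) hC37G cVar
        hcVar hvarB hMd mN hnbr).M261 δ ≤ (geo9Y (f j)).M →
      Ineq261 (d261 δ) (toB6 (geo9Y (f j)) 0 True) δ α)
    (h32 : B9.Thm32Printed (d + 1) c35 (fun j => geo9Y (f j)) (fun j => bg9YC (Matrix (Fin N) (Fin N) ℂ) G (extraYPb (Matrix (Fin N) (Fin N) ℂ) G) (f j)) (CinvY (extraYPb (Matrix (Fin N) (Fin N) ℂ) G) f G parA))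
    (h33 : B9.Thm33Printed c35 (fun j => geo9Y (f j)) (fun j => (codingYx (extraYPb (Matrix (Fin N) (Fin N) ℂ) G) G (f j) (C37 j) (C38 j)).bg)
      (fun j => KSCUPar (extraYPb (Matrix (Fin N) (Fin N) ℂ) G) G (f j) (parA j) (parSymY (f j).toKIdx) (C37 j) (C38 j))
      (fun j => KACU (extraYPb (Matrix (Fin N) (Fin N) ℂ) G) G (f j) (GAY (f j).toKIdx (parA j) (parBY (f j).toKIdx) (GpY (f j).toKIdx (parA j))) (parBY (f j).toKIdx) (C37 j) (C38 j))) :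
    SectBStepUPar (extraYPb (Matrix (Fin N) (Fin N) ℂ) G) f (d + 1) c35 G b parA (fun j => parSymY (f j).toKIdx) (fun j => GAY (f j).toKIdx (parA j) (parBY (f j).toKIdx) (GpY (f j).toKIdx (parA j)))
      (fun j => parBY (f j).toKIdx) C37 C38 (CinvY (extraYPb (Matrix (Fin N) (Fin N) ℂ) G) f G parA) :=
  sectBStepUPar_parSymYH_of_members (extraYPb (Matrix (Fin N) (Fin N) ℂ) G) f c35 G b ιB C38 parA C37 hι hG1 hpar hunit M₂ hM₂ hrepr hcR hcL Cq hCq hC37 MInv aInv aW hMInv haInv haW hunitX hsym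
    hunitA hb₁ (c335Plaq ℓ aInv) (c335Plaq_nonneg ℓ haInv.le) (hreg335P_extraYPb G f ιB hι hMd aInv c35) hC37G cVar hcVar hvarB hMd mN hnbr hMr
    (cP := 2 * c335Plaq ℓ aInv) (mul_nonneg zero_le_two (c335Plaq_nonneg ℓ haInv.le))
    (fun j α₀ U hM hα hMa hU => plaqLawY_of_reg335PlaqY G (f j) (ιB j) hG1 hU.1.1 (c335Plaq_nonneg ℓ haInv.le)
      (hreg335P_extraYPb G f ιB hι hMd aInv c35 j α₀ U hM hα hMa hU))
    d261 h261 h32 h33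

end Literature.MathematicalPhysics.QuantumFieldTheory.Balaban1983to89.B9SectBStepUParHExtraYPb

end
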